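/-
Copyright: cell pub-balaban-gaps (YM BLITZ Y1, track G1), seat g1-p2 GEN 9 (unit `pub-balaban-gaps-g1-p2`).  Row (D4) NODE O,
OBJECT level: the ℓ^∞-NEUMANN INVERTIBILITY from block letters — shared by the one-scale covariant propagator (GEN 7's
`D4WalkBlockCovariantPropagator`) and the multi-level averaging slot (GEN 8's `D4WalkBlockShiftWeightedAv`), hence ONE file both import
(the lemmas were staged identically in both; text = GEN 7∕8's, moved verbatim).  HONEST FRAMING: elementary (operator norm from block
letters + cube row sum; `‖M‖ < 1 ⟹ 1 − M` invertible); nothing of Bałaban's asserted; (D4) instance 0∕1; NOT BetaPertH, NOT continuum,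
NOT Clay.
-/
import Summits.QuantumFields.BalabanUV.Gaps.D4WalkBlock

/-!
# `Gaps.D4WalkBlockLettersNeumann` — `‖M‖_{ℓ^∞→ℓ^∞} ≤ B·c_μ` from block letters `‖M‖_{Y,Y′} ≤ Be^{−μd₁(Y,Y′)}` and the cube row sum
# `(μ, c_μ)`; `Bc_μ < 1 ⟹ 1 − M` invertible (cell pub-balaban-gaps, seat g1-p2 gen 9; lemmas by GEN 7∕8)

HONEST DEPENDENCY (cell pub-balaban, verbatim): continuum YM on T⁴ ⇐ BetaPertH ∧ nine spine estimates (0/9 proved);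
BetaPertH ⇐ (D1) ∧ (D4) ∧ CAP+tail.

* `norm_le_of_blockLetters`, `isUnit_one_sub_of_blockLetters` ([B9] (3.62)–(3.64): the Neumann series of the perturbation step
  converges in the ℓ^∞-operator norm).
References: T. Bałaban, Comm. Math. Phys. **99** (1985) 389–434 [B9], (3.62)–(3.64) p. 402, (3.108) p. 416.
-/

noncomputable section

namespace Summit.QuantumFields.BalabanUV.Gaps.D4WalkBlockLettersNeumann

open Metric Set Finset
open scoped Matrix
open Literature.MathematicalPhysics.QuantumFieldTheory.Balaban1983to89
open Literature.MathematicalPhysics.QuantumFieldTheory.Balaban1983to89.B9Thm34Ext (toB6)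
open Literature.MathematicalPhysics.QuantumFieldTheory.Balaban1983to89.B9Thm37GlueTorus (torusGeom tdist1 tdist1_self tdist1_nonneg)
open Literature.MathematicalPhysics.QuantumFieldTheory.Balaban1983to89.B5TorusCover (UT)
open Literature.MathematicalPhysics.QuantumFieldTheory.Balaban1983to89.B11SectG (RowSum)
open Summit.QuantumFields.BalabanUV.Gaps.D4WalkBlock (rowMass blockNorm rowMass_le_blockNorm)

variable {ν : ℕ} {Kv : Fin ν → ℕ}

section Unit
open scoped Matrix.Norms.Operator

variable {p : Type} [Fintype p] [DecidableEq p] [∀ i, NeZero (Kv i)]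

/-- The `ℓ^∞`-operator norm of `M` from block letters `‖M‖_{Y,Y′} ≤ Be^{−μd₁(Y,Y′)}` and the cube row sum `(μ, c_μ)`: `‖M‖ ≤ Bc_μ`.
[cite: Balaban1985BackgroundPropagators, (3.62)–(3.64) p.402, (3.108) p.416] -/
theorem norm_le_of_blockLetters (cub : p → UT Kv) (M : Matrix p p ℂ) {B μ cμ : ℝ} (hB : 0 ≤ B) (hcμ : 0 ≤ cμ)
    (hM : ∀ Y Y', blockNorm cub cub M Y Y' ≤ B * Real.exp (-(μ * tdist1 Kv Y Y')))
    (hrow : RowSum (toB6 (torusGeom Kv 0 0 0) 0 True) μ cμ) : ‖M‖ ≤ B * cμ := by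
  have hrows : ∀ i, ∑ j, ‖M i j‖ ≤ B * cμ := fun i => by
    calc ∑ j, ‖M i j‖ = ∑ Y', rowMass cub M i Y' := by
            simp only [rowMass]
            exact (Finset.sum_fiberwise (Finset.univ) cub (fun j => ‖M i j‖)).symm
      _ ≤ ∑ Y', B * Real.exp (-(μ * tdist1 Kv (cub i) Y')) :=
            Finset.sum_le_sum fun Y' _ => (rowMass_le_blockNorm cub cub M i Y').trans (hM _ _)
      _ = B * ∑ Y', Real.exp (-(μ * tdist1 Kv (cub i) Y')) := by rw [Finset.mul_sum]
      _ ≤ B * cμ := mul_le_mul_of_nonneg_left (hrow (cub i)) hB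
  rw [Matrix.linfty_opNorm_def, ← Real.coe_toNNReal (B * cμ) (mul_nonneg hB hcμ), NNReal.coe_le_coe]
  refine Finset.sup_le fun i _ => ?_
  rw [← NNReal.coe_le_coe, Real.coe_toNNReal _ (mul_nonneg hB hcμ)]
  simp only [NNReal.coe_sum, coe_nnnorm]
  exact hrows i

/-- **`1 − M` IS INVERTIBLE** when `M` has block letters `Be^{−μd₁}`, the cubes have the row sum `(μ, c_μ)` and `Bc_μ < 1` (Neumann
series in the `ℓ^∞`-operator norm; adapted from GEN 7's staged one-scale §2). [cite: Balaban1985BackgroundPropagators, p.402 («the inverse is given by a convergent Neumann series»)] -/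
theorem isUnit_one_sub_of_blockLetters (cub : p → UT Kv) (M : Matrix p p ℂ) {B μ cμ : ℝ} (hB : 0 ≤ B) (hcμ : 0 ≤ cμ)
    (hM : ∀ Y Y', blockNorm cub cub M Y Y' ≤ B * Real.exp (-(μ * tdist1 Kv Y Y')))
    (hrow : RowSum (toB6 (torusGeom Kv 0 0 0) 0 True) μ cμ) (hq : B * cμ < 1) : IsUnit (1 - M).det := by
  have hn : ‖M‖ < 1 := (norm_le_of_blockLetters cub M hB hcμ hM hrow).trans_lt hq
  exact (Matrix.isUnit_iff_isUnit_det _).1 ⟨Units.oneSub M hn, rfl⟩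

end Unit

end Summit.QuantumFields.BalabanUV.Gaps.D4WalkBlockLettersNeumann

end
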